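import Summits.BirchSwinnertonDyer.BirchSwinnertonDyer.Theorems.SignedLowerHalvesSmallImageLowerHalfBothSignsValveKernel
import Summits.BirchSwinnertonDyer.BirchSwinnertonDyer.Theorems.SignedLowerHalvesSmallImageLowerHalfBothSignsValveDepletionAlgebra
import Literature.NumberTheory.EllipticCurves.PAdicLFunctionDistributionProofs
import Literature.NumberTheory.EllipticCurves.PAdicLFunctionIntegralityAtTwoProofs
import HarnessLib

/-!
# Route `SignedLowerHalves`, crux L `SmallImageLowerHalfBothSigns` (item stmt-BirchSwinnertonDyer-23599), line `rtt_w3` — crux idea `valve`,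
# brick B2 PROVED: the `S₀`-DEPLETED plus symbol of `W`'s newform is a `p`-adic unit at some `p`-power cusp (every odd supersingular good `p`)

Width seat `bsd-line-slh-p3-w3` g15 under LEAD `cruxlead-stmt-BirchSwinnertonDyer-23599` (cell `bsd-ssimc`); ROUTE-INDEPENDENT helper
(`--supports stmt-BirchSwinnertonDyer-23599`); THEOREMS ONLY (no definition, no named fact, no `sorry`); closes nothing; BSD / crux L / crux M
are proved for NO curve by this. With `…ValveKernel.lean` (p758736: kernel K + base case of B2) the floor stub `stub_muOneSign_ns_ge5` at a pair
now follows from the CM-side certificate B1 ALONE (plus the K-chain's Vatsal output): the W-side brick B2 of card `valve` is a theorem, by an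
IHARA-FREE road («layer headroom» without λ-bookkeeping):

* §1 `sum_ratPlusSymbol_fibre_eq_neg` — the Hecke relation at `p` with `a_p = 0` as a FIBRE RELATION
  `Σ_{j<p} [(a + j p^{n+1})/p^{n+2}]⁺_f = −[a/p^n]⁺_f`; propagation `exists_coprime_norm_eq_one_add_two[_mul]`: a unit value at a unit residue of
  level `n` gives one at level `n + 2k`; base `exists_coprime_norm_eq_one` (THEOREM B via `exists_norm_ratPlusSymbol_div_pow_eq_one`, `[−r]⁺ = [r]⁺`).
* §2 ★ `exists_norm_depletedSymbol_eq_one` — for ANY finite family of integers `ℓ_i > 1` prime to `p` and polynomials `P_i ∈ ℤ[X]` of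
  degree `≤ 2` with `P_i(0) = 1` (the Euler factors `L_ℓ(W, X)` of the depletion), SOME depleted value
  `Σ_{k : ι → {0,1,2}} (∏_i [X^{k_i}]P_i · ℓ_i^{−k_i}) · [(∏_i ℓ_i^{k_i})·a/p^n]⁺_f` is a `p`-adic UNIT. Proof: if all depleted values at level
  `n + 2` were non-units, the reduction `c(u) = [u/p^{n+2}]⁺ mod p` on `(ℤ/p^{n+2})ˣ` would be killed by the depletion operator, hence constant on
  the fibres `{a + j p^{n+1}}` (`…ValveDepletionAlgebra.exists_unit_eq_add_mul_and_apply_eq`), so `Σ_j [(a+jp^{n+1})/p^{n+2}]⁺ ≡ p·[a/p^{n+2}]⁺ ≡ 0`,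
  i.e. `[a/p^n]⁺ ≡ 0` for every unit residue `a` — contradicting §1 at a suitable large `n` of the parity of THEOREM B's level.

References: [MazurTateTeitelbaum1986Invent] §I.4 (4.2), §I.10 (10.1); [GreenbergVatsal2000] §1 (8)–(9), §3 Rem. (3.4); [Vatsal1999] Rem. (1.12);
[EmertonPollackWeston2006] §3.3–3.4 (the Ihara road this file avoids).
-/

set_option autoImplicit false
-- D-0017: single-problem summit, the namespace repeats the problem name by design.
set_option linter.dupNamespace false
noncomputable section

open scoped Classical MatrixGroups ModularForm
open Polynomial CongruenceSubgroup Literature.NumberTheory.EllipticCurves Literature.NumberTheory.EllipticCurves.ModularForms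
  Summit.BirchSwinnertonDyer.BirchSwinnertonDyer.Theorems.SmallImageHeckePrimeMu

namespace Summit.BirchSwinnertonDyer.BirchSwinnertonDyer.Theorems.SmallImageValve

variable {p : ℕ} [hp : Fact p.Prime] {N : ℕ} [NeZero N] {W : WeierstrassCurve ℚ} [W.IsElliptic] [W.IsGloballyMinimal]
  {f : CuspForm (Gamma0 N) 2}

/-! ## §1 The Hecke relation at `p` (`a_p = 0`) as a fibre relation; propagation of unit values; the base level -/

/-- **Fibre relation**: `Σ_{j<p} [(a + j p^{n+1})/p^{n+2}]⁺_f = −[a/p^n]⁺_f` for the newform of `W` at a good prime with `a_p(W) = 0`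
(the Hecke relation `a_p[r]⁺ = Σ_j [(r+j)/p]⁺ + [pr]⁺` at `r = a/p^{n+1}`). [cite: MazurTateTeitelbaum1986Invent, §I.4 (4.2)] -/
theorem sum_ratPlusSymbol_fibre_eq_neg (hf : IsNewformOf W f) (hgood : W.HasGoodReductionAtPrime p) (hap : W.frobeniusTrace p = 0)
    (n : ℕ) (a : ℕ) :
    ∑ j : Fin p, ratPlusSymbol f (((a : ℚ) + ((j : ℕ) : ℚ) * (p : ℚ) ^ (n + 1)) / (p : ℚ) ^ (n + 2)) =
      - ratPlusSymbol f ((a : ℚ) / (p : ℚ) ^ n) := by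
  have hp' : p.Prime := hp.out
  have hpN : ¬ p ∣ N := not_dvd_level_of_isNewformOf hf hgood
  have hap' : cuspCoeff f p = ((0 : ℤ) : ℂ) := by rw [cuspCoeff_eq_frobeniusTrace_of_isNewformOf_holds hf hgood, hap]
  have h := intCast_mul_ratPlusSymbol (p := p) hf.1 hp' hpN hap' (ratCast_ratPlusSymbol_holds hf.1 hf.coeffField_eq_bot)
    ((a : ℚ) / (p : ℚ) ^ (n + 1))
  have hp0 : (p : ℚ) ≠ 0 := by exact_mod_cast hp'.ne_zero
  rw [Int.cast_zero, zero_mul, eq_comm, add_eq_zero_iff_eq_neg] at h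
  have harg : ∀ j : Fin p, ((a : ℚ) / (p : ℚ) ^ (n + 1) + ((j : ℕ) : ℚ)) / (p : ℚ) =
      ((a : ℚ) + ((j : ℕ) : ℚ) * (p : ℚ) ^ (n + 1)) / (p : ℚ) ^ (n + 2) := fun j ↦ by
    field_simp; ring
  have harg' : (p : ℚ) * ((a : ℚ) / (p : ℚ) ^ (n + 1)) = (a : ℚ) / (p : ℚ) ^ n := by field_simp; ring
  simpa only [harg, harg'] using h

/-- **Propagation `n → n + 2`**: a unit value `[a/p^n]⁺_f` at a residue `a` prime to `p` forces a unit value `[a'/p^{n+2}]⁺_f` at some `a' ≡ a`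
prime to `p` (fibre relation + ultrametric inequality; the values are `p`-integral since `a_p = 0`). [cite: MazurTateTeitelbaum1986Invent, §I.4 (4.2)] -/
theorem exists_coprime_norm_eq_one_add_two (hp2 : p ≠ 2) (hf : IsNewformOf W f) (hgood : W.HasGoodReductionAtPrime p)
    (hap : W.frobeniusTrace p = 0) {n : ℕ} (h : ∃ a : ℕ, ¬ p ∣ a ∧ ‖((ratPlusSymbol f ((a : ℚ) / (p : ℚ) ^ n) : ℚ) : ℚ_[p])‖ = 1) :
    ∃ a : ℕ, ¬ p ∣ a ∧ ‖((ratPlusSymbol f ((a : ℚ) / (p : ℚ) ^ (n + 2)) : ℚ) : ℚ_[p])‖ = 1 := by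
  obtain ⟨a, hpa, ha⟩ := h
  have hpN : ¬ p ∣ N := not_dvd_level_of_isNewformOf hf hgood
  have hap' : cuspCoeff f p = ((0 : ℤ) : ℂ) := by rw [cuspCoeff_eq_frobeniusTrace_of_isNewformOf_holds hf hgood, hap]
  have hint : ∀ j : Fin p,
      ‖((ratPlusSymbol f (((a : ℚ) + ((j : ℕ) : ℚ) * (p : ℚ) ^ (n + 1)) / (p : ℚ) ^ (n + 2)) : ℚ) : ℚ_[p])‖ ≤ 1 := fun j ↦ by
    have := norm_ratPlusSymbol_intCast_div_pow_le_one f hp2 hf.1 hpN hap' ((a + (j : ℕ) * p ^ (n + 1) : ℕ) : ℤ) (n + 2)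
    push_cast at this ⊢
    exact this
  by_contra hne
  push Not at hne
  have hlt : ∀ j : Fin p,
      ‖((ratPlusSymbol f (((a : ℚ) + ((j : ℕ) : ℚ) * (p : ℚ) ^ (n + 1)) / (p : ℚ) ^ (n + 2)) : ℚ) : ℚ_[p])‖ < 1 := by
    intro j
    refine lt_of_le_of_ne (hint j) fun hj ↦ hne (a + (j : ℕ) * p ^ (n + 1)) ?_ (by push_cast; exact hj)
    rw [Nat.dvd_add_left (Dvd.dvd.mul_left (dvd_pow_self p (Nat.succ_ne_zero n)) _)]
    exact hpa
  have hsum := sum_ratPlusSymbol_fibre_eq_neg hf hgood hap n a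
  have : ‖((ratPlusSymbol f ((a : ℚ) / (p : ℚ) ^ n) : ℚ) : ℚ_[p])‖ < 1 := by
    rw [← norm_neg, ← Rat.cast_neg, ← hsum, Rat.cast_sum]
    haveI : NeZero p := ⟨hp.out.ne_zero⟩
    obtain ⟨j, -, hj⟩ := IsUltrametricDist.exists_norm_finsetSum_le_of_nonempty (Finset.univ_nonempty (α := Fin p))
      (fun j : Fin p ↦ ((ratPlusSymbol f (((a : ℚ) + ((j : ℕ) : ℚ) * (p : ℚ) ^ (n + 1)) / (p : ℚ) ^ (n + 2)) : ℚ) : ℚ_[p]))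
    exact lt_of_le_of_lt hj (hlt j)
  exact absurd ha this.ne

/-- Propagation iterated: from level `n` to every level `n + 2k`. [cite: MazurTateTeitelbaum1986Invent, §I.4 (4.2)] -/
theorem exists_coprime_norm_eq_one_add_two_mul (hp2 : p ≠ 2) (hf : IsNewformOf W f) (hgood : W.HasGoodReductionAtPrime p)
    (hap : W.frobeniusTrace p = 0) {n : ℕ} (h : ∃ a : ℕ, ¬ p ∣ a ∧ ‖((ratPlusSymbol f ((a : ℚ) / (p : ℚ) ^ n) : ℚ) : ℚ_[p])‖ = 1)
    (k : ℕ) : ∃ a : ℕ, ¬ p ∣ a ∧ ‖((ratPlusSymbol f ((a : ℚ) / (p : ℚ) ^ (n + 2 * k)) : ℚ) : ℚ_[p])‖ = 1 := by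
  induction k with
  | zero => simpa using h
  | succ k ih =>
    rw [show n + 2 * (k + 1) = (n + 2 * k) + 2 by ring]
    exact exists_coprime_norm_eq_one_add_two hp2 hf hgood hap ih

/-- **Base level** (THEOREM B): some `[a/p^m]⁺_f` with `p ∤ a` is a `p`-adic unit (`exists_norm_ratPlusSymbol_div_pow_eq_one` gives a unit value
`[z/p^n]⁺`, `z ∈ ℤ`; `[−r]⁺ = [r]⁺`, `z = ±p^e a`, and `[0]⁺ = [1]⁺`). [cite: MazurTateTeitelbaum1986Invent, §I.10 (10.1)] -/
theorem exists_coprime_norm_eq_one (hp2 : p ≠ 2) (hf : IsNewformOf W f) (hgood : W.HasGoodReductionAtPrime p)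
    (hap : W.frobeniusTrace p = 0) :
    ∃ (m : ℕ) (a : ℕ), ¬ p ∣ a ∧ ‖((ratPlusSymbol f ((a : ℚ) / (p : ℚ) ^ m) : ℚ) : ℚ_[p])‖ = 1 := by
  obtain ⟨n, z, hz⟩ := exists_norm_ratPlusSymbol_div_pow_eq_one hp2 hf hgood hap
  -- pass to `|z|`
  have habs : ratPlusSymbol f (((z.natAbs : ℕ) : ℚ) / (p : ℚ) ^ n) = ratPlusSymbol f ((z : ℚ) / (p : ℚ) ^ n) := by
    rcases Int.natAbs_eq z with h | h
    · conv_rhs => rw [h]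
      rw [Int.cast_natCast]
    · conv_rhs => rw [h]
      rw [Int.cast_neg, Int.cast_natCast, neg_div, ratPlusSymbol_neg]
  rw [← habs] at hz
  rcases Nat.eq_zero_or_pos z.natAbs with h0 | hpos
  · -- `[0]⁺ = [1]⁺ = [1/p^0]⁺`
    refine ⟨0, 1, hp.out.not_dvd_one, ?_⟩
    rw [h0, Nat.cast_zero, zero_div] at hz
    rw [pow_zero, div_one, Nat.cast_one, show (1 : ℚ) = 0 + ((1 : ℤ) : ℚ) by norm_num, ratPlusSymbol_add_intCast_eq]
    exact hz
  · obtain ⟨e, a, hpa, hea⟩ := Nat.exists_eq_pow_mul_and_not_dvd hpos.ne' p hp.out.ne_one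
    have hp0 : ∀ k : ℕ, (p : ℚ) ^ k ≠ 0 := fun k ↦ pow_ne_zero _ (by exact_mod_cast hp.out.ne_zero)
    rcases le_or_gt e n with hen | hen
    · obtain ⟨d, rfl⟩ := Nat.exists_eq_add_of_le hen
      refine ⟨d, a, hpa, ?_⟩
      have : (((z.natAbs : ℕ) : ℚ) / (p : ℚ) ^ (e + d)) = (a : ℚ) / (p : ℚ) ^ d := by
        rw [hea, Nat.cast_mul, Nat.cast_pow, pow_add, mul_div_mul_left _ _ (hp0 e)]
      rwa [this] at hz
    · -- `z/p^n` is an integer: the value is `[0]⁺ = [1]⁺`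
      obtain ⟨d, rfl⟩ := Nat.exists_eq_add_of_lt hen
      refine ⟨0, 1, hp.out.not_dvd_one, ?_⟩
      have hint : (((z.natAbs : ℕ) : ℚ) / (p : ℚ) ^ n) = 0 + (((p ^ (d + 1) * a : ℕ) : ℤ) : ℚ) := by
        rw [hea, zero_add, Int.cast_natCast, Nat.cast_mul, Nat.cast_mul, Nat.cast_pow, Nat.cast_pow,
          show n + d + 1 = n + (d + 1) by ring, pow_add, mul_assoc, mul_div_cancel_left₀ _ (hp0 n)]
      rw [hint, ratPlusSymbol_add_intCast_eq] at hz
      rw [pow_zero, div_one, Nat.cast_one, show (1 : ℚ) = 0 + ((1 : ℤ) : ℚ) by norm_num, ratPlusSymbol_add_intCast_eq]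
      exact hz

/-! ## §2 Brick B2: the `S₀`-depleted plus symbol has a unit value at some `p`-power cusp -/

/-- Equal classes mod `p^L` give equal symbols `[x/p^L]⁺ = [y/p^L]⁺` (`1`-periodicity of `[·]⁺_f`). [cite: MazurTateTeitelbaum1986Invent, §I.4] -/
theorem ratPlusSymbol_div_pow_eq_of_natCast_eq (f : CuspForm (Gamma0 N) 2) {L x y : ℕ}
    (hxy : (x : ZMod (p ^ L)) = (y : ZMod (p ^ L))) :
    ratPlusSymbol f ((x : ℚ) / (p : ℚ) ^ L) = ratPlusSymbol f ((y : ℚ) / (p : ℚ) ^ L) := by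
  rw [ZMod.natCast_eq_natCast_iff'] at hxy
  have hpL : ((p : ℚ) ^ L) ≠ 0 := pow_ne_zero _ (by exact_mod_cast hp.out.ne_zero)
  have hsplit : ∀ z : ℕ, (z : ℚ) / (p : ℚ) ^ L = ((z % p ^ L : ℕ) : ℚ) / (p : ℚ) ^ L + (((z / p ^ L : ℕ) : ℤ) : ℚ) := by
    intro z
    have hz : (z : ℚ) = (p : ℚ) ^ L * ((z / p ^ L : ℕ) : ℚ) + ((z % p ^ L : ℕ) : ℚ) := by
      exact_mod_cast (Nat.div_add_mod z (p ^ L)).symm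
    rw [Int.cast_natCast, hz, add_div, mul_div_cancel_left₀ _ hpL, add_comm]
  rw [hsplit x, hsplit y, hxy, ratPlusSymbol_add_intCast_eq, ratPlusSymbol_add_intCast_eq]

/-- ★ §2 **Brick B2 of card `valve` — depleted primitivity, PROVED.** `W/ℚ` with newform `f`, `p` odd of good SUPERSINGULAR reduction
(`a_p(W) = 0`); any finite family of integers `ℓ_i > 1` prime to `p` and polynomials `P_i ∈ ℤ[X]` with `P_i(0) = 1`, of which only the
coefficients of `1, X, X²` enter (for the K-chain: the primes of `S₀` and the Euler factors `L_{ℓ}(W, X)`, of degree `≤ 2`). Then SOME `S₀`-depleted value of the `Ω⁺_f`-normalised plus symbol at a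
`p`-power cusp with unit numerator, `Σ_{k : ι → {0,1,2}} (∏_i [X^{k_i}]P_i · ℓ_i^{−k_i}) · [(∏_i ℓ_i^{k_i}) · a/p^n]⁺_f`, is a `p`-adic UNIT.
Ihara-free: THEOREM B (`exists_coprime_norm_eq_one`) + Hecke fibre relation at `p` (`sum_ratPlusSymbol_fibre_eq_neg`, propagation to a large level
of the same parity) + the annihilator lemma `…ValveDepletionAlgebra.exists_unit_eq_add_mul_and_apply_eq` (all depleted values non-units ⟹ the
reduction of `u ↦ [u/p^{n+2}]⁺` is constant on the fibres `{a + jp^{n+1}}` ⟹ `[a/p^n]⁺ ≡ 0` at every unit residue).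
[cite: GreenbergVatsal2000, §1 (8)–(9) and §3 Remark (3.4)] [cite: Vatsal1999, Remark (1.12)] [cite: MazurTateTeitelbaum1986Invent, §I.4 (4.2)] -/
theorem exists_norm_depletedSymbol_eq_one (hp2 : p ≠ 2) (hf : IsNewformOf W f) (hgood : W.HasGoodReductionAtPrime p)
    (hap : W.frobeniusTrace p = 0) {ι : Type*} [Fintype ι] [DecidableEq ι] (ℓ : ι → ℕ) (hℓ : ∀ i, 1 < ℓ i ∧ ¬ p ∣ ℓ i)
    (P : ι → ℤ[X]) (hP0 : ∀ i, (P i).coeff 0 = 1) :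
    ∃ (n : ℕ) (a : ℕ), ¬ p ∣ a ∧
      ‖((∑ k ∈ Fintype.piFinset (fun _ : ι ↦ Finset.range 3),
          (∏ i, ((P i).coeff (k i) : ℚ) * ((ℓ i : ℚ) ^ (k i))⁻¹) *
            ratPlusSymbol f (((∏ i, ℓ i ^ (k i) : ℕ) : ℚ) * ((a : ℚ) / (p : ℚ) ^ n)) : ℚ) : ℚ_[p])‖ = 1 := by
  have hp' := hp.out
  have hpN : ¬ p ∣ N := not_dvd_level_of_isNewformOf hf hgood
  have hap' : cuspCoeff f p = ((0 : ℤ) : ℂ) := by rw [cuspCoeff_eq_frobeniusTrace_of_isNewformOf_holds hf hgood, hap]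
  -- parameters `b`, `w` and the level `L = m + 2`
  set b : ℕ := 2 * Fintype.card ι with hb
  have hbp : 2 * Fintype.card ι ≤ p ^ b := (Nat.lt_two_pow_self).le.trans (Nat.pow_le_pow_left hp'.two_le _)
  set w : ℕ := ∑ i, padicValNat p (ℓ i ^ (p ^ 2 - 1) - 1) with hw
  have hwi : ∀ i, padicValNat p (ℓ i ^ (p ^ 2 - 1) - 1) ≤ w := fun i ↦
    Finset.single_le_sum (f := fun i ↦ padicValNat p (ℓ i ^ (p ^ 2 - 1) - 1)) (fun _ _ ↦ Nat.zero_le _) (Finset.mem_univ i)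
  obtain ⟨m₀, a₀, hpa₀, ha₀⟩ := exists_coprime_norm_eq_one hp2 hf hgood hap
  obtain ⟨a₁, hpa₁, ha₁⟩ := exists_coprime_norm_eq_one_add_two_mul hp2 hf hgood hap ⟨a₀, hpa₀, ha₀⟩ (w + b)
  set m : ℕ := m₀ + 2 * (w + b) with hm
  by_contra hcon
  push Not at hcon
  -- integrality
  have hint : ∀ c : ℕ, ‖((ratPlusSymbol f ((c : ℚ) / (p : ℚ) ^ (m + 2)) : ℚ) : ℚ_[p])‖ ≤ 1 := fun c ↦ by
    have h := norm_ratPlusSymbol_intCast_div_pow_le_one f hp2 hf.1 hpN hap' (c : ℤ) (m + 2)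
    rwa [Int.cast_natCast] at h
  have hcoef : ∀ i (j : ℕ), ‖((((P i).coeff j : ℚ) * ((ℓ i : ℚ) ^ j)⁻¹ : ℚ) : ℚ_[p])‖ ≤ 1 := by
    intro i j
    have hℓ1 : ‖((ℓ i : ℕ) : ℚ_[p])‖ = 1 :=
      Padic.norm_natCast_eq_one_iff.mpr ((Nat.Prime.coprime_iff_not_dvd hp').mpr (hℓ i).2)
    rw [Rat.cast_mul, Rat.cast_inv, Rat.cast_pow, Rat.cast_natCast, Rat.cast_intCast, norm_mul, norm_inv, norm_pow, hℓ1, one_pow,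
      inv_one, mul_one]
    exact Padic.norm_int_le_one _
  -- units `σ_i = ℓ_i mod p^{m+2}` and the mod-`p` Euler factors `Q_i`
  have hcop : ∀ i, (ℓ i).Coprime (p ^ (m + 2)) := fun i ↦ (((Nat.Prime.coprime_iff_not_dvd hp').mpr (hℓ i).2).symm).pow_right _
  set σ : ι → (ZMod (p ^ (m + 2)))ˣ := fun i ↦ ZMod.unitOfCoprime (ℓ i) (hcop i) with hσdef
  have hσ : ∀ i, (σ i : ZMod (p ^ (m + 2))) = ℓ i := fun i ↦ ZMod.coe_unitOfCoprime _ _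
  set q : ι → ℕ → ℤ_[p] := fun i j ↦ ⟨((((P i).coeff j : ℚ) * ((ℓ i : ℚ) ^ j)⁻¹ : ℚ) : ℚ_[p]), hcoef i j⟩ with hqdef
  set Q : ι → (ZMod p)[X] := fun i ↦
    C (PadicInt.toZMod (q i 2)) * X ^ 2 + C (PadicInt.toZMod (q i 1)) * X + C (PadicInt.toZMod (q i 0)) with hQdef
  have hQdeg : ∀ i, (Q i).natDegree ≤ 2 := fun i ↦ natDegree_quadratic_le
  have hQcoeff : ∀ i, ∀ j < 3, (Q i).coeff j = PadicInt.toZMod (q i j) := by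
    intro i j hj
    interval_cases j <;> simp [hQdef, coeff_X, coeff_C, coeff_X_pow]
  have hQ0 : ∀ i, (Q i).coeff 0 ≠ 0 := by
    intro i
    have h1 : q i 0 = 1 := PadicInt.ext (by simp [hqdef, hP0 i])
    rw [hQcoeff i 0 (by norm_num), h1, map_one]
    exact one_ne_zero
  have hker : ∀ x : ℤ_[p], PadicInt.toZMod x = 0 ↔ ‖x‖ < 1 := fun x ↦ by
    rw [← RingHom.mem_ker, PadicInt.ker_toZMod, IsLocalRing.mem_maximalIdeal, PadicInt.mem_nonunits]
  -- the function `c(u) = [u/p^{m+2}]⁺ mod p`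
  set Xv : (ZMod (p ^ (m + 2)))ˣ → ℤ_[p] := fun u ↦
    ⟨((ratPlusSymbol f ((((u : ZMod (p ^ (m + 2))).val : ℕ) : ℚ) / (p : ℚ) ^ (m + 2)) : ℚ) : ℚ_[p]), hint _⟩ with hXv
  set c : (ZMod (p ^ (m + 2)))ˣ → ZMod p := fun u ↦ PadicInt.toZMod (Xv u) with hcdef
  -- all depleted values at level `m + 2` are non-units ⟹ the hypothesis of the annihilator lemma
  have hc : ∀ u : (ZMod (p ^ (m + 2)))ˣ, ∑ k ∈ Fintype.piFinset (fun _ : ι ↦ Finset.range 3),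
      (∏ i, (Q i).coeff (k i)) * c ((∏ i, σ i ^ (k i)) * u) = 0 := by
    intro u
    have hk : ∀ k ∈ Fintype.piFinset (fun _ : ι ↦ Finset.range 3),
        (∏ i, (Q i).coeff (k i)) * c ((∏ i, σ i ^ (k i)) * u) =
          PadicInt.toZMod ((∏ i, q i (k i)) * Xv ((∏ i, σ i ^ (k i)) * u)) := by
      intro k hk
      rw [map_mul, map_prod]
      congr 1
      exact Finset.prod_congr rfl fun i _ ↦ hQcoeff i (k i) (Finset.mem_range.mp (Fintype.mem_piFinset.mp hk i))
    rw [Finset.sum_congr rfl hk, ← map_sum, hker]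
    have hu : ¬ p ∣ ((u : ZMod (p ^ (m + 2))).val : ℕ) := fun hdvd ↦ by
      have h := (ZMod.val_coe_unit_coprime u).coprime_dvd_right (dvd_pow_self p (Nat.succ_ne_zero (m + 1)))
      exact (Nat.Prime.coprime_iff_not_dvd hp').mp (Nat.coprime_comm.mp h) hdvd
    have hXcoe : ∀ v : (ZMod (p ^ (m + 2)))ˣ, ((Xv v : ℤ_[p]) : ℚ_[p]) =
        ((ratPlusSymbol f ((((v : ZMod (p ^ (m + 2))).val : ℕ) : ℚ) / (p : ℚ) ^ (m + 2)) : ℚ) : ℚ_[p]) := fun v ↦ rfl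
    have hqcoe : ∀ i (j : ℕ), ((q i j : ℤ_[p]) : ℚ_[p]) = ((((P i).coeff j : ℚ) * ((ℓ i : ℚ) ^ j)⁻¹ : ℚ) : ℚ_[p]) :=
      fun i j ↦ rfl
    have hval : ∀ k : ι → ℕ, (((∏ i, q i (k i)) * Xv ((∏ i, σ i ^ (k i)) * u) : ℤ_[p]) : ℚ_[p]) =
        (((∏ i, ((P i).coeff (k i) : ℚ) * ((ℓ i : ℚ) ^ (k i))⁻¹) *
          ratPlusSymbol f (((∏ i, ℓ i ^ (k i) : ℕ) : ℚ) * (((((u : ZMod (p ^ (m + 2))).val : ℕ) : ℚ)) / (p : ℚ) ^ (m + 2))) : ℚ) :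
            ℚ_[p]) := by
      intro k
      have hprod : (((∏ i, q i (k i) : ℤ_[p])) : ℚ_[p]) = ∏ i, ((q i (k i) : ℤ_[p]) : ℚ_[p]) := by
        simp [← PadicInt.Coe.ringHom_apply, map_prod PadicInt.Coe.ringHom]
      rw [PadicInt.coe_mul, hprod, Rat.cast_mul, Rat.cast_prod, hXcoe]
      simp only [hqcoe]
      congr 2
      rw [ratPlusSymbol_div_pow_eq_of_natCast_eq f (y := (∏ i, ℓ i ^ (k i)) * ((u : ZMod (p ^ (m + 2))).val : ℕ))]
      · push_cast; ring
      · rw [ZMod.natCast_zmod_val]; push_cast; simp only [hσ, ZMod.natCast_val, ZMod.cast_id', id]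
    have h1 : ‖(∑ k ∈ Fintype.piFinset (fun _ : ι ↦ Finset.range 3), (∏ i, q i (k i)) * Xv ((∏ i, σ i ^ (k i)) * u) : ℤ_[p])‖ ≤ 1 :=
      PadicInt.norm_le_one _
    rw [PadicInt.norm_def, PadicInt.coe_sum, Finset.sum_congr rfl fun k _ ↦ hval k, ← Rat.cast_sum] at h1 ⊢
    exact lt_of_le_of_ne h1 (hcon (m + 2) _ hu)
  -- the annihilator lemma: `c` is constant on the fibre of `a₁`
  have hL2 : b + 2 ≤ m + 2 := by omega
  have hLi : ∀ i, padicValNat p (ℓ i ^ (p ^ 2 - 1) - 1) + b + 1 ≤ m + 2 := fun i ↦ by have := hwi i; omega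
  have hcop₁ : a₁.Coprime (p ^ (m + 2)) := (((Nat.Prime.coprime_iff_not_dvd hp').mpr hpa₁).symm).pow_right _
  set u₁ : (ZMod (p ^ (m + 2)))ˣ := ZMod.unitOfCoprime a₁ hcop₁ with hu₁
  have hfib : ∀ j : ℕ, ∃ u : (ZMod (p ^ (m + 2)))ˣ,
      (u : ZMod (p ^ (m + 2))) = u₁ + j * (p : ZMod (p ^ (m + 2))) ^ (m + 2 - 1) ∧ c u = c u₁ := fun j ↦
    exists_unit_eq_add_mul_and_apply_eq hp2 ℓ hℓ σ hσ Q hQdeg hQ0 hbp hL2 hLi c hc u₁ j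
  choose u hu using hfib
  have hsym : ∀ j : Fin p, ratPlusSymbol f (((a₁ : ℚ) + ((j : ℕ) : ℚ) * (p : ℚ) ^ (m + 1)) / (p : ℚ) ^ (m + 2)) =
      ratPlusSymbol f ((((u j : ZMod (p ^ (m + 2))).val : ℕ) : ℚ) / (p : ℚ) ^ (m + 2)) := by
    intro j
    have h := ratPlusSymbol_div_pow_eq_of_natCast_eq f (L := m + 2) (x := a₁ + (j : ℕ) * p ^ (m + 1))
      (y := (u j : ZMod (p ^ (m + 2))).val) (by
        rw [ZMod.natCast_zmod_val, (hu j).1, hu₁, ZMod.coe_unitOfCoprime, show m + 2 - 1 = m + 1 by omega]; push_cast; ring)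
    push_cast at h
    exact h
  have hzero' : ∑ j : Fin p, c (u j) = 0 := by
    rw [Finset.sum_congr rfl fun (j : Fin p) _ ↦ (hu (j : ℕ)).2, Finset.sum_const, Finset.card_univ, Fintype.card_fin,
      nsmul_eq_mul, ZMod.natCast_self, zero_mul]
  have hzero : PadicInt.toZMod (∑ j : Fin p, Xv (u j)) = 0 := by rw [map_sum]; exact hzero'
  rw [hker, PadicInt.norm_def, PadicInt.coe_sum] at hzero
  have hsum : (∑ j : Fin p, ((Xv (u j) : ℤ_[p]) : ℚ_[p])) = ((- ratPlusSymbol f ((a₁ : ℚ) / (p : ℚ) ^ m) : ℚ) : ℚ_[p]) := by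
    rw [← sum_ratPlusSymbol_fibre_eq_neg hf hgood hap m a₁, Rat.cast_sum]
    exact Finset.sum_congr rfl fun j _ ↦ by rw [hsym j]
  rw [hsum, Rat.cast_neg, norm_neg] at hzero
  exact absurd ha₁ hzero.ne

end Summit.BirchSwinnertonDyer.BirchSwinnertonDyer.Theorems.SmallImageValve

end
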